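import Summits.QuantumFields.YangMills.Theorems.ColdStartUniversalityColdStartSolutionsExistTruncated
import Summits.QuantumFields.YangMills.Theorems.ColdStartUniversalityColdStartSolutionsExistProgressive
import Literature.MathematicalPhysics.QuantumLattice.GaugeGroups
import HarnessLib

/-!
# Route `ColdStartUniversality`, rung `stub_fixedCutoffMixing` of K_A1 (stmt-QuantumFields-24809):
# the SZZ coefficients are continuous and bounded on `SU(2)^E`

Helper file (seat `ym-line-csu-p1`, g6) for the step [2→SZZ] of the `WilsonMeasureLangevinInvariant` wall
(hypotheses `hbM`, `hσM`, coefficient progressivity of `dynkin_expectation_flat_of_contDiff`): restricted to the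
group, drift and noise of `latticeLangevinDynamics (fundamentalLatticeRep 2) β` are continuous functions of the
configuration `U ∈ SU(2)^E` (they agree there with the globally Lipschitz truncated coefficients of
`exists_truncatedCoefficients`), hence — `SU(2)^E` being compact — bounded: `continuous_drift_matrixConfig`,
`continuous_noise_matrixConfig`, `exists_bound_coeff`.  No definition, no sorry, standard axioms.  RECORD-rung
plumbing (R3); the Yang–Mills mass gap is NOT proved.
-/

set_option autoImplicit false

noncomputable section

namespace Summit.QuantumFields.YangMills.Theorems.ColdStartUniversality

open MeasureTheory Filter Finset
open scoped NNReal
open Literature.MathematicalPhysics.QuantumFieldTheory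
open Literature.MathematicalPhysics.QuantumLattice (fundamentalRep fundamentalLatticeRep continuous_fundamentalRep)

variable {L : ℕ} [NeZero L]

omit [NeZero L] in
/-- `U ↦ matrixConfig ρ U` is continuous on `SU(2)^E`. [folklore] -/
theorem continuous_matrixConfig_su2 :
    Continuous fun U : GaugeConfig 3 L (Matrix.specialUnitaryGroup (Fin 2) ℂ) =>
      matrixConfig (fundamentalRep (Fin 2)) U :=
  continuous_pi fun e => (continuous_fundamentalRep (n := Fin 2)).comp (continuous_apply e)

/-- **The SZZ drift is continuous on the group**: `U ↦ drift(matrixConfig ρ U) e` is continuous on `SU(2)^E`.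
[folklore] -/
theorem continuous_drift_matrixConfig (β : ℝ) (e : Edge 3 L) :
    Continuous fun U : GaugeConfig 3 L (Matrix.specialUnitaryGroup (Fin 2) ℂ) =>
      (latticeLangevinDynamics (fundamentalLatticeRep 2) β).drift (matrixConfig (fundamentalRep (Fin 2)) U) e := by
  obtain ⟨S, ⟨⟨K, hK⟩, -⟩, -, hAgree⟩ := exists_truncatedCoefficients L β
  have hSc : Continuous fun Q : MatrixConfig 3 L 2 => S.drift Q e :=
    continuous_of_hsForm_lipschitz fun Q Q' => (hK Q Q' e).1
  have heq : (fun U : GaugeConfig 3 L (Matrix.specialUnitaryGroup (Fin 2) ℂ) =>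
      (latticeLangevinDynamics (fundamentalLatticeRep 2) β).drift (matrixConfig (fundamentalRep (Fin 2)) U) e) =
      fun U => S.drift (matrixConfig (fundamentalRep (Fin 2)) U) e := by
    funext U; exact ((hAgree U e).1).symm
  rw [heq]
  exact hSc.comp continuous_matrixConfig_su2

/-- **The SZZ noise coefficients are continuous on the group.** [folklore] -/
theorem continuous_noise_matrixConfig (β : ℝ) (e : Edge 3 L) (n : NoiseIdx 2) :
    Continuous fun U : GaugeConfig 3 L (Matrix.specialUnitaryGroup (Fin 2) ℂ) =>
      (latticeLangevinDynamics (fundamentalLatticeRep 2) β).noise (matrixConfig (fundamentalRep (Fin 2)) U) e n := by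
  obtain ⟨S, ⟨⟨K, hK⟩, -⟩, -, hAgree⟩ := exists_truncatedCoefficients L β
  have hSc : Continuous fun Q : MatrixConfig 3 L 2 => S.noise Q e n :=
    continuous_of_hsForm_lipschitz fun Q Q' => (hK Q Q' e).2 n
  have heq : (fun U : GaugeConfig 3 L (Matrix.specialUnitaryGroup (Fin 2) ℂ) =>
      (latticeLangevinDynamics (fundamentalLatticeRep 2) β).noise (matrixConfig (fundamentalRep (Fin 2)) U) e n) =
      fun U => S.noise (matrixConfig (fundamentalRep (Fin 2)) U) e n := by
    funext U; exact ((hAgree U e).2 n).symm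
  rw [heq]
  exact hSc.comp continuous_matrixConfig_su2

/-- **The SZZ coefficients are bounded on the group**: there is `M` with `‖drift(ρU) e i j‖ ≤ M` and
`‖noise(ρU) e n i j‖ ≤ M` for all `U ∈ SU(2)^E`, `e, n, i, j` (continuity on the compact `SU(2)^E`). [folklore] -/
theorem exists_bound_coeff (β : ℝ) :
    ∃ M : ℝ, ∀ (U : GaugeConfig 3 L (Matrix.specialUnitaryGroup (Fin 2) ℂ)) (e : Edge 3 L) (i j : Fin 2),
      ‖(latticeLangevinDynamics (fundamentalLatticeRep 2) β).drift (matrixConfig (fundamentalRep (Fin 2)) U) e i j‖ ≤ M ∧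
      ∀ n : NoiseIdx 2,
        ‖(latticeLangevinDynamics (fundamentalLatticeRep 2) β).noise (matrixConfig (fundamentalRep (Fin 2)) U) e n i j‖
          ≤ M := by
  -- each entry is a continuous real-valued (norm) function on a compact space
  have hd : ∀ (e : Edge 3 L) (i j : Fin 2), ∃ C, ∀ U : GaugeConfig 3 L (Matrix.specialUnitaryGroup (Fin 2) ℂ),
      ‖(latticeLangevinDynamics (fundamentalLatticeRep 2) β).drift (matrixConfig (fundamentalRep (Fin 2)) U) e i j‖ ≤ C := by
    intro e i j
    have hc : Continuous fun U : GaugeConfig 3 L (Matrix.specialUnitaryGroup (Fin 2) ℂ) =>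
        ‖(latticeLangevinDynamics (fundamentalLatticeRep 2) β).drift (matrixConfig (fundamentalRep (Fin 2)) U) e i j‖ :=
      (((continuous_apply j).comp ((continuous_apply i).comp (continuous_drift_matrixConfig β e)))).norm
    obtain ⟨C, hC⟩ := (isCompact_univ.image hc).isBounded.subset_closedBall_lt 0 0 |>.imp fun C h => h
    refine ⟨C, fun U => ?_⟩
    have hmem := hC.2 (Set.mem_image_of_mem _ (Set.mem_univ U))
    rw [Metric.mem_closedBall, dist_zero_right, Real.norm_eq_abs, abs_of_nonneg (norm_nonneg _)] at hmem
    exact hmem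
  have hn : ∀ (e : Edge 3 L) (n : NoiseIdx 2) (i j : Fin 2), ∃ C,
      ∀ U : GaugeConfig 3 L (Matrix.specialUnitaryGroup (Fin 2) ℂ),
      ‖(latticeLangevinDynamics (fundamentalLatticeRep 2) β).noise (matrixConfig (fundamentalRep (Fin 2)) U) e n i j‖
        ≤ C := by
    intro e n i j
    have hc : Continuous fun U : GaugeConfig 3 L (Matrix.specialUnitaryGroup (Fin 2) ℂ) =>
        ‖(latticeLangevinDynamics (fundamentalLatticeRep 2) β).noise (matrixConfig (fundamentalRep (Fin 2)) U) e n i j‖ :=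
      (((continuous_apply j).comp ((continuous_apply i).comp (continuous_noise_matrixConfig β e n)))).norm
    obtain ⟨C, hC⟩ := (isCompact_univ.image hc).isBounded.subset_closedBall_lt 0 0 |>.imp fun C h => h
    refine ⟨C, fun U => ?_⟩
    have hmem := hC.2 (Set.mem_image_of_mem _ (Set.mem_univ U))
    rw [Metric.mem_closedBall, dist_zero_right, Real.norm_eq_abs, abs_of_nonneg (norm_nonneg _)] at hmem
    exact hmem
  choose Cd hCd using hd
  choose Cn hCn using hn
  refine ⟨(∑ e, ∑ i, ∑ j, |Cd e i j|) + ∑ e, ∑ n, ∑ i, ∑ j, |Cn e n i j|, fun U e i j => ⟨?_, fun n => ?_⟩⟩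
  · have h1 : |Cd e i j| ≤ ∑ e, ∑ i, ∑ j, |Cd e i j| := by
      have a := single_le_sum (f := fun j => |Cd e i j|) (fun _ _ => abs_nonneg _) (mem_univ j)
      have b := single_le_sum (f := fun i => ∑ j, |Cd e i j|) (fun _ _ => sum_nonneg fun _ _ => abs_nonneg _)
        (mem_univ i)
      have c := single_le_sum (f := fun e => ∑ i, ∑ j, |Cd e i j|)
        (fun _ _ => sum_nonneg fun _ _ => sum_nonneg fun _ _ => abs_nonneg _) (mem_univ e)
      exact a.trans (b.trans c)
    have h2 : 0 ≤ ∑ e, ∑ n, ∑ i, ∑ j, |Cn e n i j| :=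
      sum_nonneg fun _ _ => sum_nonneg fun _ _ => sum_nonneg fun _ _ => sum_nonneg fun _ _ => abs_nonneg _
    exact ((hCd e i j U).trans (le_abs_self _)).trans (by linarith)
  · have h1 : |Cn e n i j| ≤ ∑ e, ∑ n, ∑ i, ∑ j, |Cn e n i j| := by
      have a := single_le_sum (f := fun j => |Cn e n i j|) (fun _ _ => abs_nonneg _) (mem_univ j)
      have b := single_le_sum (f := fun i => ∑ j, |Cn e n i j|) (fun _ _ => sum_nonneg fun _ _ => abs_nonneg _)
        (mem_univ i)
      have c := single_le_sum (f := fun n => ∑ i, ∑ j, |Cn e n i j|)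
        (fun _ _ => sum_nonneg fun _ _ => sum_nonneg fun _ _ => abs_nonneg _) (mem_univ n)
      have d := single_le_sum (f := fun e => ∑ n, ∑ i, ∑ j, |Cn e n i j|)
        (fun _ _ => sum_nonneg fun _ _ => sum_nonneg fun _ _ => sum_nonneg fun _ _ => abs_nonneg _) (mem_univ e)
      exact a.trans (b.trans (c.trans d))
    have h2 : 0 ≤ ∑ e, ∑ i, ∑ j, |Cd e i j| :=
      sum_nonneg fun _ _ => sum_nonneg fun _ _ => sum_nonneg fun _ _ => abs_nonneg _
    exact ((hCn e n i j U).trans (le_abs_self _)).trans (by linarith)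

end Summit.QuantumFields.YangMills.Theorems.ColdStartUniversality

end
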